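import Summits.Ventures.DiscreteObjects.Hadamard.ConferenceGraph333Centralizer83
import Summits.Ventures.DiscreteObjects.Hadamard.ConferenceGraph333Centralizer41
import Summits.Ventures.DiscreteObjects.Hadamard.ConferenceGraph333LargePrimeOrders
import Summits.Ventures.DiscreteObjects.Hadamard.ConferenceGraph333SylowBounds

/-!
# Centralisers of elements of order `83` and `41` in an automorphism group of srg(333,166,82,83) have order `p` or `2p` (kernel)

Framing: lottery ticket; floor = certified bounds/negative ranges.  Cell pub-namedobj (venture DiscreteObjects),
target (H) = `H(668)`, hadamard gen 32.  GROUP-LEVEL plumbing of the local structure at the primes `83` and `41` (HANDOFF-H-g30 item 3b,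
HANDOFF-H-g31 item 4): the element-level facts — `83 ∣ orderOf σ ⇒ orderOf σ ∈ {83, 166}`, `41 ∣ orderOf σ ⇒ orderOf σ ∈ {41, 82}`
(`ConferenceGraph333LargePrimeOrders`), no two distinct commuting involutions commute with an element of order `83` / `41`
(`ConferenceGraph333Centralizer83`, `…Centralizer41`), `83², 41² ∤ |G|` (`ConferenceGraph333SylowBounds`) — assembled with Cauchy and Sylow:
for a group `C` of automorphisms all of whose elements commute with a member `ρ` of prime order `p`,
* `centralizer_card_aux` — arithmetic: `p ∣ |C|`, prime divisors of `|C|` in `{2, p}`, `4 ∤ |C|`, `p² ∤ |C|` ⇒ `|C| ∈ {p, 2p}`;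
* **`centralizer83_card`** — `p = 83`: `|C| = 83` or `166` (a subgroup of order `4` of `C` would be cyclic — an element of order `332` — or a
  four-group — two commuting involutions centralising `ρ`);
* **`centralizer41_card`** — `p = 41`: `|C| = 41` or `82`.
In words: the centraliser of an element of order `83` (resp. `41`) in Aut(srg(333,166,82,83)) is `ℤ/83` or `ℤ/166` (resp. `ℤ/41` or `ℤ/82`) as far
as its ORDER goes.  WORDS: structure of a HYPOTHETICAL object; ours (PROVISIONAL; standard group theory).  No `sorry`, no new definitions.
-/

namespace Summit.Ventures.DiscreteObjects.Hadamard

open Finset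

section centralizerCards
variable {V : Type*} [Fintype V] [DecidableEq V]

omit [Fintype V] [DecidableEq V] in
/-- arithmetic core: `p ∣ n`, prime divisors of `n` in `{2, p}` (`p` odd), `4 ∤ n`, `p² ∤ n` ⇒ `n = p ∨ n = 2p`. -/
private theorem card_eq_of_prime_divisors {p n : ℕ} (hp : p.Prime) (hp2 : p ≠ 2) (hpn : p ∣ n)
    (hprimes : ∀ q : ℕ, q.Prime → q ∣ n → q = 2 ∨ q = p) (h4 : ¬ 4 ∣ n) (hpp : ¬ p ^ 2 ∣ n) :
    n = p ∨ n = 2 * p := by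
  obtain ⟨m, rfl⟩ := hpn
  rcases Nat.eq_two_pow_or_exists_odd_prime_and_dvd m with ⟨k, rfl⟩ | ⟨q, hq, hqm, hqodd⟩
  · rcases k with _ | _ | k
    · left; simp
    · right; ring
    · exfalso; apply h4
      exact ⟨p * 2 ^ k, by ring⟩
  · exfalso
    have hq2 : q ≠ 2 := by rintro rfl; exact (Nat.not_even_iff_odd.mpr hqodd) even_two
    rcases hprimes q hq (Dvd.dvd.mul_left hqm p) with h | h
    · exact hq2 h
    · subst h
      exact hpp (by rw [pow_two]; exact Nat.mul_dvd_mul_left q hqm)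

/-- **Centraliser structure, general step.**  `C` a group of automorphisms whose elements all commute with `ρ ∈ C` of odd prime order `p`;
if (i) every automorphism `σ` with `p ∣ orderOf σ` has `orderOf σ ∈ {p, 2p}`, (ii) no two distinct commuting involutive automorphisms both
commute with `ρ`, and (iii) `p² ∤ |C|`, then `|C| ∈ {p, 2p}` (Cauchy for the prime divisors; a subgroup of order `4` is cyclic or a four-group). -/
theorem centralizer_card_aux (A : Matrix V V ℤ) {p : ℕ} (hp : p.Prime) (hp2 : p ≠ 2)
    (C : Subgroup (Equiv.Perm V)) (hC : ∀ g ∈ C, ∀ x y, A (g x) (g y) = A x y)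
    (ρ : Equiv.Perm V) (hρC : ρ ∈ C) (hρo : orderOf ρ = p) (hcomm : ∀ g ∈ C, g * ρ = ρ * g)
    (horders : ∀ σ : Equiv.Perm V, (∀ x y, A (σ x) (σ y) = A x y) → p ∣ orderOf σ → orderOf σ = p ∨ orderOf σ = 2 * p)
    (hinv : ∀ τ₁ τ₂ : Equiv.Perm V, τ₁ ^ 2 = 1 → τ₁ ≠ 1 → τ₂ ^ 2 = 1 → τ₂ ≠ 1 → τ₁ ≠ τ₂ → ρ * τ₁ = τ₁ * ρ → ρ * τ₂ = τ₂ * ρ →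
      τ₁ * τ₂ = τ₂ * τ₁ → (∀ x y, A (τ₁ x) (τ₁ y) = A x y) → (∀ x y, A (τ₂ x) (τ₂ y) = A x y) → False)
    (hpp : ¬ p ^ 2 ∣ Nat.card C) :
    Nat.card C = p ∨ Nat.card C = 2 * p := by
  classical
  have hp1 : 1 < p := hp.one_lt
  -- an automorphism commuting with ρ of order q coprime to p gives one of order q·p
  have hmulorder : ∀ g : Equiv.Perm V, g ∈ C → Nat.Coprime (orderOf g) p → orderOf (g * ρ) = orderOf g * p := by
    intro g hg hcop
    have hcg : Commute g ρ := hcomm g hg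
    rw [← hρo] at hcop ⊢
    exact hcg.orderOf_mul_eq_mul_orderOf_of_coprime hcop
  have hAmul : ∀ g : Equiv.Perm V, g ∈ C → ∀ x y, A ((g * ρ) x) ((g * ρ) y) = A x y := by
    intro g hg x y
    rw [Equiv.Perm.mul_apply, Equiv.Perm.mul_apply, hC g hg, hC ρ hρC]
  -- (a) prime divisors of |C| are 2 or p
  have hprimes : ∀ q : ℕ, q.Prime → q ∣ Nat.card C → q = 2 ∨ q = p := by
    intro q hq hqd
    haveI := Fact.mk hq
    obtain ⟨g, hg⟩ := exists_prime_orderOf_dvd_card' q hqd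
    have hg' : orderOf (g : Equiv.Perm V) = q := by rw [Subgroup.orderOf_coe, hg]
    by_cases hqp : q = p
    · exact Or.inr hqp
    · have hcop : Nat.Coprime (orderOf (g : Equiv.Perm V)) p := by rw [hg']; exact (Nat.coprime_primes hq hp).mpr hqp
      have ho := hmulorder g g.2 hcop
      rw [hg'] at ho
      have hdvd : p ∣ orderOf ((g : Equiv.Perm V) * ρ) := by rw [ho]; exact Dvd.intro_left q rfl
      rcases horders _ (hAmul g g.2) hdvd with h | h <;> rw [ho] at h
      · exfalso
        have : q = 1 := by
          have := Nat.eq_of_mul_eq_mul_right hp.pos (h.trans (one_mul p).symm)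
          exact this
        exact hq.one_lt.ne' this
      · left; exact Nat.eq_of_mul_eq_mul_right hp.pos h
  -- (b) 4 ∤ |C|
  have h4 : ¬ 4 ∣ Nat.card C := by
    intro h4
    haveI := Fact.mk Nat.prime_two
    have h4' : 2 ^ 2 ∣ Nat.card C := by rw [show (2 : ℕ) ^ 2 = 4 by norm_num]; exact h4
    obtain ⟨K, hK⟩ := Sylow.exists_subgroup_card_pow_prime (G := C) 2 (n := 2) h4'
    have hcommK : ∀ a b : K, a * b = b * a := fun a b =>
      (IsPGroup.isMulCommutative_of_card_eq_prime_sq hK).is_comm.comm a b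
    -- coercion of an element of K to a permutation
    have hKperm : ∀ k : K, ((k : C) : Equiv.Perm V) ∈ C := fun k => (k : C).2
    have hord : ∀ k : K, orderOf ((k : C) : Equiv.Perm V) = orderOf k := fun k => by
      rw [Subgroup.orderOf_coe, Subgroup.orderOf_coe]
    by_cases hex : ∃ k : K, orderOf k = 4
    · obtain ⟨k, hk4⟩ := hex
      have hk4' : orderOf ((k : C) : Equiv.Perm V) = 4 := by rw [hord, hk4]
      have hcop : Nat.Coprime (orderOf ((k : C) : Equiv.Perm V)) p := by
        rw [hk4', show (4 : ℕ) = 2 ^ 2 by norm_num]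
        exact Nat.Coprime.pow_left 2 ((Nat.coprime_primes Nat.prime_two hp).mpr hp2.symm)
      have ho := hmulorder _ (hKperm k) hcop
      rw [hk4'] at ho
      have hdvd : p ∣ orderOf (((k : C) : Equiv.Perm V) * ρ) := by rw [ho]; exact Dvd.intro_left 4 rfl
      rcases horders _ (hAmul _ (hKperm k)) hdvd with h | h <;> rw [ho] at h <;> omega
    · -- every element of K is an involution or trivial: pick two distinct non-trivial ones
      push Not at hex
      have hsq : ∀ k : K, ((k : C) : Equiv.Perm V) ^ 2 = 1 := by
        intro k
        have hd : orderOf k ∣ 2 ^ 2 := by rw [← hK]; exact orderOf_dvd_natCard k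
        obtain ⟨i, hi, hio⟩ := (Nat.dvd_prime_pow Nat.prime_two).mp hd
        have hi2 : i ≠ 2 := by rintro rfl; exact hex k (by rw [hio]; norm_num)
        have hd2 : orderOf ((k : C) : Equiv.Perm V) ∣ 2 := by
          rw [hord, hio]
          interval_cases i
          · norm_num
          · norm_num
          · exact absurd rfl hi2
        exact orderOf_dvd_iff_pow_eq_one.mp hd2
      haveI : Fintype K := Fintype.ofFinite K
      have hK4 : Fintype.card K = 4 := by rw [← Nat.card_eq_fintype_card, hK]; norm_num
      obtain ⟨a, b, c, hab, hac, hbc⟩ := Fintype.two_lt_card_iff.mp (by rw [hK4]; norm_num)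
      -- two distinct non-trivial elements among a, b, c
      have key : ∃ u v : K, u ≠ 1 ∧ v ≠ 1 ∧ u ≠ v := by
        by_cases ha : a = 1
        · refine ⟨b, c, ?_, ?_, hbc⟩
          · rintro rfl; exact hab ha
          · rintro rfl; exact hac ha
        · by_cases hb : b = 1
          · refine ⟨a, c, ha, ?_, hac⟩
            rintro rfl; exact hbc hb
          · exact ⟨a, b, ha, hb, hab⟩
      obtain ⟨u, v, hu, hv, huv⟩ := key
      have hne1 : ∀ w : K, w ≠ 1 → ((w : C) : Equiv.Perm V) ≠ 1 := by
        intro w hw h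
        exact hw (Subtype.ext (Subtype.ext h))
      have huv' : ((u : C) : Equiv.Perm V) ≠ ((v : C) : Equiv.Perm V) := by
        intro h
        apply huv
        exact Subtype.ext (Subtype.ext h)
      have hcuv : ((u : C) : Equiv.Perm V) * ((v : C) : Equiv.Perm V) = ((v : C) : Equiv.Perm V) * ((u : C) : Equiv.Perm V) := by
        have := congrArg (fun z : K => ((z : C) : Equiv.Perm V)) (hcommK u v)
        simpa using this
      exact hinv _ _ (hsq u) (hne1 u hu) (hsq v) (hne1 v hv) huv'
        ((hcomm _ (hKperm u)).symm) ((hcomm _ (hKperm v)).symm) hcuv (hC _ (hKperm u)) (hC _ (hKperm v))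
  -- (c) p ∣ |C|
  have hpC : p ∣ Nat.card C := by
    have h := orderOf_dvd_natCard (⟨ρ, hρC⟩ : C)
    rwa [Subgroup.orderOf_mk, hρo] at h
  exact card_eq_of_prime_divisors hp hp2 hpC hprimes h4 hpp

/-- **`|C(ρ₈₃)| ∈ {83, 166}`**: a group of automorphisms of an `srg(333,166,82,83)` whose elements all commute with a member `ρ` of order `83`
has order `83` or `166`. -/
theorem centralizer83_card (hV : Fintype.card V = 333) (A : Matrix V V ℤ)
    (h01 : ∀ x y, A x y = 0 ∨ A x y = 1) (hsymm : ∀ x y, A y x = A x y) (hdiag : ∀ x, A x x = 0)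
    (hk : ∀ x, ∑ y, A x y = 166) (hsrg : ∀ x y, ∑ z, A x z * A z y = 83 * (1 + (if x = y then 1 else 0)) - A x y)
    (C : Subgroup (Equiv.Perm V)) (hC : ∀ g ∈ C, ∀ x y, A (g x) (g y) = A x y)
    (ρ : Equiv.Perm V) (hρ : ρ ^ 83 = 1) (hρ1 : ρ ≠ 1) (hρC : ρ ∈ C) (hcomm : ∀ g ∈ C, g * ρ = ρ * g) :
    Nat.card C = 83 ∨ Nat.card C = 166 := by
  haveI := Fact.mk (show Nat.Prime 83 by norm_num)
  have hρo : orderOf ρ = 83 := orderOf_eq_prime hρ hρ1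
  have hAρ := hC ρ hρC
  obtain ⟨-, -, -, h83⟩ := autGroup_card_not_dvd_23_37_41_83_sq hV A h01 hsymm hdiag hk hsrg C hC
  exact centralizer_card_aux A (by norm_num) (by norm_num) C hC ρ hρC hρo hcomm
    (fun σ hA h => aut_orderOf_of_83_dvd hV A h01 hsymm hdiag hk hsrg σ hA h)
    (fun τ₁ τ₂ h1 h1ne h2 h2ne hne hc1 hc2 hc12 hA1 hA2 =>
      no_two_involutions_centralizing_order83 hV A h01 hsymm hdiag hk hsrg ρ τ₁ τ₂ hρ hρ1 h1 h1ne h2 h2ne hne hc1 hc2 hc12 hAρ hA1 hA2)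
    h83

/-- **`|C(ρ₄₁)| ∈ {41, 82}`**: a group of automorphisms of an `srg(333,166,82,83)` whose elements all commute with a member `ρ` of order `41`
has order `41` or `82`. -/
theorem centralizer41_card (hV : Fintype.card V = 333) (A : Matrix V V ℤ)
    (h01 : ∀ x y, A x y = 0 ∨ A x y = 1) (hsymm : ∀ x y, A y x = A x y) (hdiag : ∀ x, A x x = 0)
    (hk : ∀ x, ∑ y, A x y = 166) (hsrg : ∀ x y, ∑ z, A x z * A z y = 83 * (1 + (if x = y then 1 else 0)) - A x y)
    (C : Subgroup (Equiv.Perm V)) (hC : ∀ g ∈ C, ∀ x y, A (g x) (g y) = A x y)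
    (ρ : Equiv.Perm V) (hρ : ρ ^ 41 = 1) (hρ1 : ρ ≠ 1) (hρC : ρ ∈ C) (hcomm : ∀ g ∈ C, g * ρ = ρ * g) :
    Nat.card C = 41 ∨ Nat.card C = 82 := by
  haveI := Fact.mk (show Nat.Prime 41 by norm_num)
  have hρo : orderOf ρ = 41 := orderOf_eq_prime hρ hρ1
  have hAρ := hC ρ hρC
  obtain ⟨-, -, h41, -⟩ := autGroup_card_not_dvd_23_37_41_83_sq hV A h01 hsymm hdiag hk hsrg C hC
  exact centralizer_card_aux A (by norm_num) (by norm_num) C hC ρ hρC hρo hcomm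
    (fun σ hA h => aut_orderOf_of_41_dvd hV A h01 hsymm hdiag hk hsrg σ hA h)
    (fun τ₁ τ₂ h1 h1ne h2 h2ne hne hc1 hc2 hc12 hA1 hA2 =>
      no_two_involutions_centralizing_order41 hV A h01 hsymm hdiag hk hsrg ρ τ₁ τ₂ hρ hρ1 h1 h2 h1ne h2ne hne hc1 hc2 hc12 hAρ hA1 hA2)
    h41

end centralizerCards

end Summit.Ventures.DiscreteObjects.Hadamard
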